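import Mathlib.Geometry.Manifold.MFDeriv.Basic
import Mathlib.Geometry.Euclidean.Volume.Measure
import Mathlib.Analysis.Calculus.ContDiff.RCLike
import Mathlib.MeasureTheory.Measure.Lebesgue.EqHaar
import HarnessLib

/-!
# Images of compact manifolds under `C¹` immersions have Hausdorff measure growth `≤ C ρ^d` on balls

Topic `Literature/MeasureTheory/Hausdorff` (namespace `Literature.MeasureTheory.Hausdorff`).
Let `M` be a compact manifold modelled on a finite-dimensional real normed space `E`
(boundaryless model with corners `I`; no `IsManifold` hypothesis is needed), `d = dim E`, and
`f : M → F` a map into a real normed space which is `C¹` with injective differential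
`mfderiv I 𝓘(ℝ, F) f x` at every point (a `C¹` immersion; no injectivity of `f` is assumed).
Then the image is **upper Ahlfors `d`-regular**:

* `exists_hausdorffMeasure_range_inter_ball_le` — there is `C < ∞` with
  `μH[d] (range f ∩ ball p ρ) ≤ C ρ^d` for every centre `p ∈ F` and every radius `ρ`.

This is the area-growth bound `𝓗ⁿ(Σ ∩ B_ρ(p)) ≤ C ρⁿ` of a closed immersed submanifold which
makes its Gaussian areas `(4πt)^{-n/2} ∫_Σ e^{-|x-p|²/4t} d𝓗ⁿ` bounded uniformly in `(p, t)`,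
i.e. its Colding–Minicozzi entropy finite (`ColdingMinicozziEntropyFinite.lean`;
Colding–Minicozzi 2012, Lemma 7.2).

## Proof

* `exists_nhds_mul_norm_sub_le_of_hasStrictFDerivAt` — **a `C¹` map with injective
  differential is locally co-Lipschitz**: if `HasStrictFDerivAt g A x` with `A` injective on the
  finite-dimensional space `E`, then `c ‖y - z‖ ≤ ‖g y - g z‖` for `y, z` near `x`, some
  `c > 0` (`A` is bounded below on `E`, Mathlib's `LinearMap.exists_antilipschitzWith`, and
  strict differentiability gives `‖g y - g z - A (y - z)‖ ≤ ε ‖y - z‖`).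
* `hausdorffMeasure_image_inter_ball_le` — **a bi-Lipschitz image meets balls in measure
  `≤ C ρ^d`**: if `g` is `L`-Lipschitz and `c`-co-Lipschitz on `K ⊆ E`, then
  `μH[d] (g '' K ∩ ball p ρ) ≤ L^d (2ρ/c)^d μH[d] (closedBall 0 1)`, because the part of `K`
  mapped into `ball p ρ` has diameter `≤ 2ρ/c`, so lies in a closed ball of radius `2ρ/c`,
  whose `μH[d]`-measure scales like `(2ρ/c)^d` (`μH[dim E]` is an additive Haar measure), and
  Lipschitz maps increase `μH[d]` by at most `L^d` (Federer 1969, 2.10.11; Mathlib's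
  `LipschitzOnWith.hausdorffMeasure_image_le`).
* `exists_chart_piece_hausdorffMeasure_inter_ball_le` — around each `x ∈ M`, read `f` in the
  extended chart: `f ∘ (extChartAt I x)⁻¹` is `C¹` with injective derivative at the chart
  image of `x`, hence Lipschitz and co-Lipschitz on a small closed ball there; its image of
  that ball is a neighbourhood piece of `f(M)` with growth `≤ C_x ρ^d`.
* compactness: finitely many pieces cover `M`, and the constants add.

Everything is proved; no definitions and no named facts are introduced.

## References

* H. Federer, *Geometric Measure Theory*, Springer (1969), 2.10.11 (Hausdorff measure under
  Lipschitzian maps). [Federer1969]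
* T. H. Colding, W. P. Minicozzi II, *Generic mean curvature flow I; generic singularities*,
  Ann. of Math. 175 (2012), Lemma 7.2. [ColdingMinicozzi2012]
-/

noncomputable section

open Set Function Filter Module Metric
open _root_.MeasureTheory _root_.MeasureTheory.Measure
open scoped ENNReal NNReal Topology Manifold

namespace Literature.MeasureTheory.Hausdorff

/-! ### `C¹` maps with injective differential are locally co-Lipschitz -/

section CoLipschitz

variable {E F : Type*} [NormedAddCommGroup E] [NormedSpace ℝ E] [FiniteDimensional ℝ E]
  [NormedAddCommGroup F] [NormedSpace ℝ F]

/-- **A strictly differentiable map with injective differential is co-Lipschitz near the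
point**: if `HasStrictFDerivAt g A x` on a finite-dimensional space and `A` is injective, there
are `c > 0` and a neighbourhood `U` of `x` with `c ‖y - z‖ ≤ ‖g y - g z‖` for all `y, z ∈ U`.
Indeed `‖v‖ ≤ K ‖A v‖` (an injective linear map on a finite-dimensional space is bounded
below) and `‖g y - g z - A (y - z)‖ ≤ (2K)⁻¹ ‖y - z‖` near `x`, so `c = (2K)⁻¹` works.
[folklore] -/
theorem exists_nhds_mul_norm_sub_le_of_hasStrictFDerivAt {g : E → F} {A : E →L[ℝ] F} {x : E}
    (hg : HasStrictFDerivAt g A x) (hA : Injective A) :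
    ∃ c : ℝ, 0 < c ∧ ∃ U ∈ 𝓝 x, ∀ y ∈ U, ∀ z ∈ U, c * ‖y - z‖ ≤ ‖g y - g z‖ := by
  obtain ⟨K, hK, hanti⟩ :=
    (A : E →ₗ[ℝ] F).exists_antilipschitzWith (LinearMap.ker_eq_bot.2 hA)
  have hK' : (0 : ℝ) < K := hK
  have hε : (0 : ℝ) < (2 * (K : ℝ))⁻¹ := by positivity
  have hev := hg.isLittleO.def hε
  rw [nhds_prod_eq] at hev
  obtain ⟨U, hU, hUU⟩ := Filter.mem_prod_self_iff.1 hev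
  refine ⟨(2 * (K : ℝ))⁻¹, hε, U, hU, fun y hy z hz => ?_⟩
  have h1 : ‖y - z‖ ≤ K * ‖A (y - z)‖ := by
    have := hanti.le_mul_dist y z
    rwa [dist_eq_norm, dist_eq_norm, ← map_sub] at this
  have h2 : ‖g y - g z - A (y - z)‖ ≤ (2 * (K : ℝ))⁻¹ * ‖y - z‖ := hUU (mk_mem_prod hy hz)
  have h3 : ‖A (y - z)‖ ≤ ‖g y - g z‖ + ‖g y - g z - A (y - z)‖ := by
    have := norm_sub_le (g y - g z) (g y - g z - A (y - z))
    rwa [sub_sub_cancel] at this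
  have h4 : ‖y - z‖ / K ≤ ‖A (y - z)‖ := by
    rw [div_le_iff₀ hK']
    linarith [h1]
  have h5 : (2 * (K : ℝ))⁻¹ * ‖y - z‖ = ‖y - z‖ / K - (2 * (K : ℝ))⁻¹ * ‖y - z‖ := by
    field_simp
    ring
  linarith [h3, h4, h2, h5]

end CoLipschitz

/-! ### Bi-Lipschitz images meet balls in measure `≤ C ρ^d` -/

section BiLipschitzImage

variable {E F : Type*} [NormedAddCommGroup E] [NormedSpace ℝ E] [FiniteDimensional ℝ E]
  [MeasurableSpace E] [BorelSpace E]
  [NormedAddCommGroup F] [MeasurableSpace F] [BorelSpace F]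

/-- **Growth of a bi-Lipschitz image on balls.** If `g : E → F` is `L`-Lipschitz and
`c`-co-Lipschitz (`c ‖y - z‖ ≤ ‖g y - g z‖`, `c > 0`) on `K ⊆ E`, `d = dim E`, then for every
ball of `F`, `μH[d] (g '' K ∩ ball p ρ) ≤ L^d · (2ρ/c)^d · μH[d] (closedBall 0 1)`: the part
of `K` mapped into `ball p ρ` has diameter `≤ 2ρ/c`, so it lies in a closed ball of radius
`2ρ/c`, of `μH[d]`-measure `(2ρ/c)^d μH[d](closedBall 0 1)` (`μH[dim E]` is an additive Haar
measure, `Measure.addHaar_closedBall'`), and `μH[d](g(S)) ≤ L^d μH[d](S)` (Federer 2.10.11).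
[cite: Federer1969, 2.10.11] -/
theorem hausdorffMeasure_image_inter_ball_le {g : E → F} {K : Set E} {L : ℝ≥0}
    (hL : LipschitzOnWith L g K) {c : ℝ} (hc : 0 < c)
    (hco : ∀ y ∈ K, ∀ z ∈ K, c * ‖y - z‖ ≤ ‖g y - g z‖) (p : F) (ρ : ℝ) :
    (μH[finrank ℝ E] : Measure F) (g '' K ∩ ball p ρ) ≤
      (L : ℝ≥0∞) ^ (finrank ℝ E : ℝ) * (ENNReal.ofReal ((2 * ρ / c) ^ finrank ℝ E) *
        (μH[finrank ℝ E] : Measure E) (closedBall (0 : E) 1)) := by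
  set d := finrank ℝ E with hd
  set S := K ∩ g ⁻¹' ball p ρ with hS_def
  have hS : g '' K ∩ ball p ρ = g '' S := (image_inter_preimage g K (ball p ρ)).symm
  rw [hS]
  have h1 : (μH[d] : Measure F) (g '' S) ≤ (L : ℝ≥0∞) ^ (d : ℝ) * (μH[d] : Measure E) S :=
    (hL.mono inter_subset_left).hausdorffMeasure_image_le (Nat.cast_nonneg d)
  refine h1.trans ?_
  gcongr
  rcases S.eq_empty_or_nonempty with hSe | ⟨y₀, hy₀⟩
  · rw [hSe, measure_empty]
    exact bot_le
  · have hsub : S ⊆ closedBall y₀ (2 * ρ / c) := by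
      intro y hy
      rw [mem_closedBall, dist_eq_norm, le_div_iff₀ hc, mul_comm]
      have hlt : ‖g y - g y₀‖ < 2 * ρ := by
        have hy' : g y ∈ ball p ρ := hy.2
        have hy₀' : g y₀ ∈ ball p ρ := hy₀.2
        rw [mem_ball, dist_eq_norm] at hy' hy₀'
        calc ‖g y - g y₀‖ = ‖(g y - p) - (g y₀ - p)‖ := by rw [sub_sub_sub_cancel_right]
          _ ≤ ‖g y - p‖ + ‖g y₀ - p‖ := norm_sub_le _ _
          _ < ρ + ρ := add_lt_add hy' hy₀'
          _ = 2 * ρ := by ring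
      exact (hco y hy.1 y₀ hy₀.1).trans hlt.le
    have hρc : 0 ≤ 2 * ρ / c := by
      have := hsub hy₀
      rw [mem_closedBall] at this
      exact dist_nonneg.trans this
    calc (μH[d] : Measure E) S ≤ (μH[d] : Measure E) (closedBall y₀ (2 * ρ / c)) := measure_mono hsub
      _ = ENNReal.ofReal ((2 * ρ / c) ^ d) * (μH[d] : Measure E) (closedBall (0 : E) 1) := by
          rw [hd, Measure.addHaar_closedBall' _ _ hρc]

end BiLipschitzImage

/-! ### Compact manifolds under `C¹` immersions -/

section Manifold

variable {E : Type*} [NormedAddCommGroup E] [NormedSpace ℝ E] [FiniteDimensional ℝ E]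
  {H : Type*} [TopologicalSpace H] {I : ModelWithCorners ℝ E H} [I.Boundaryless]
  {M : Type*} [TopologicalSpace M] [ChartedSpace H M]
  {F : Type*} [NormedAddCommGroup F] [NormedSpace ℝ F] [MeasurableSpace F] [BorelSpace F]

/-- **Local piece.** If `f : M → F` is `C¹` at `x` with injective differential there (`M`
modelled on the finite-dimensional space `E` by a boundaryless model, `d = dim E`), then for
some `r > 0` the chart ball `closedBall (extChartAt I x x) r` lies in the chart target and its
image under `f ∘ (extChartAt I x)⁻¹` — a neighbourhood piece of `f(M)` around `f x` — meets
every ball of `F` in `μH[d]`-measure `≤ C ρ^d` with `C < ∞`: on a small ball the chart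
representative is Lipschitz (`ContDiffAt.exists_lipschitzOnWith`) and co-Lipschitz
(`exists_nhds_mul_norm_sub_le_of_hasStrictFDerivAt`), and
`hausdorffMeasure_image_inter_ball_le` applies. [cite: Federer1969, 2.10.11] -/
theorem exists_chart_piece_hausdorffMeasure_inter_ball_le {f : M → F} (x : M)
    (hf : ContMDiffAt I 𝓘(ℝ, F) 1 f x) (hd : Injective (mfderiv I 𝓘(ℝ, F) f x)) :
    ∃ r : ℝ, 0 < r ∧ closedBall (extChartAt I x x) r ⊆ (extChartAt I x).target ∧
      ∃ C : ℝ≥0∞, C < ∞ ∧ ∀ (p : F) (ρ : ℝ),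
        (μH[finrank ℝ E] : Measure F)
            (f '' ((extChartAt I x).symm '' closedBall (extChartAt I x x) r) ∩ ball p ρ) ≤
          C * ENNReal.ofReal (ρ ^ finrank ℝ E) := by
  borelize E
  set d := finrank ℝ E with hd_def
  set φ := extChartAt I x with hφ
  set g : E → F := f ∘ φ.symm with hg
  -- `g` is `C¹` at `φ x`, with injective derivative
  have hgd : ContDiffAt ℝ 1 g (φ x) := by
    have h := (contMDiffAt_iff.1 hf).2
    rw [I.range_eq_univ, contDiffWithinAt_univ] at h
    exact h
  have hmd : MDifferentiableAt I 𝓘(ℝ, F) f x := hf.mdifferentiableAt one_ne_zero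
  have hinj : Injective (fderiv ℝ g (φ x)) := by
    have h := hd
    rw [hmd.mfderiv, I.range_eq_univ, fderivWithin_univ] at h
    exact h
  -- co-Lipschitz and Lipschitz neighbourhoods, and a closed chart ball inside both
  obtain ⟨c, hc, U₁, hU₁, hco⟩ :=
    exists_nhds_mul_norm_sub_le_of_hasStrictFDerivAt (hgd.hasStrictFDerivAt one_ne_zero) hinj
  obtain ⟨L, U₂, hU₂, hlip⟩ := hgd.exists_lipschitzOnWith
  have htarget : φ.target ∈ 𝓝 (φ x) :=
    (isOpen_extChartAt_target (I := I) x).mem_nhds (mem_extChartAt_target (I := I) x)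
  obtain ⟨r, hr, hsub⟩ :=
    Metric.nhds_basis_closedBall.mem_iff.1 (inter_mem (inter_mem hU₁ hU₂) htarget)
  refine ⟨r, hr, hsub.trans inter_subset_right, ?_⟩
  set K := closedBall (φ x) r with hK
  have hKU₁ : K ⊆ U₁ := hsub.trans (inter_subset_left.trans inter_subset_left)
  have hKU₂ : K ⊆ U₂ := hsub.trans (inter_subset_left.trans inter_subset_right)
  set C : ℝ≥0∞ := (L : ℝ≥0∞) ^ (d : ℝ) * (ENNReal.ofReal ((2 / c) ^ d) *
    (μH[d] : Measure E) (closedBall (0 : E) 1)) with hC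
  refine ⟨C, ?_, fun p ρ => ?_⟩
  · exact ENNReal.mul_lt_top
      (ENNReal.rpow_lt_top_of_nonneg (Nat.cast_nonneg d) ENNReal.coe_ne_top)
      (ENNReal.mul_lt_top ENNReal.ofReal_lt_top (isCompact_closedBall (0 : E) 1).measure_lt_top)
  · have himg : f '' (φ.symm '' K) = g '' K := by rw [image_image]; rfl
    rw [himg]
    refine (hausdorffMeasure_image_inter_ball_le (hlip.mono hKU₂) hc
      (fun y hy z hz => hco y (hKU₁ hy) z (hKU₁ hz)) p ρ).trans (le_of_eq ?_)
    rw [hC, show 2 * ρ / c = (2 / c) * ρ by ring, mul_pow,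
      ENNReal.ofReal_mul (pow_nonneg (by positivity) _)]
    ring

/-- **Images of compact manifolds under `C¹` immersions are upper Ahlfors regular.** Let `M`
be a compact manifold modelled on the finite-dimensional space `E` by a boundaryless model with
corners `I`, `d = dim E`, and `f : M → F` a map into a real normed space which is `C¹` with
injective differential at every point. Then there is a constant `C < ∞` with
`μH[d] (range f ∩ ball p ρ) ≤ C · ρ^d` for all `p ∈ F` and all `ρ` — the area-growth bound of a
closed immersed submanifold (finitely many chart pieces of
`exists_chart_piece_hausdorffMeasure_inter_ball_le` cover `M`). [cite: Federer1969, 2.10.11] -/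
theorem exists_hausdorffMeasure_range_inter_ball_le [CompactSpace M] {f : M → F}
    (hf : ∀ x, ContMDiffAt I 𝓘(ℝ, F) 1 f x) (hd : ∀ x, Injective (mfderiv I 𝓘(ℝ, F) f x)) :
    ∃ C : ℝ≥0∞, C < ∞ ∧ ∀ (p : F) (ρ : ℝ),
      (μH[finrank ℝ E] : Measure F) (range f ∩ ball p ρ) ≤ C * ENNReal.ofReal (ρ ^ finrank ℝ E) := by
  choose r hr htarget C hC hbound using
    fun x => exists_chart_piece_hausdorffMeasure_inter_ball_le x (hf x) (hd x)
  -- the neighbourhoods `V x = φₓ.source ∩ φₓ⁻¹(ball (φₓ x) (r x))`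
  set V : M → Set M := fun x =>
    (extChartAt I x).source ∩ extChartAt I x ⁻¹' ball (extChartAt I x x) (r x) with hV
  have hVn : ∀ x, V x ∈ 𝓝 x := fun x =>
    inter_mem (extChartAt_source_mem_nhds (I := I) x)
      ((continuousAt_extChartAt (I := I) x).preimage_mem_nhds (ball_mem_nhds _ (hr x)))
  have hVsub : ∀ x, V x ⊆ (extChartAt I x).symm '' closedBall (extChartAt I x x) (r x) := by
    intro x y hy
    exact ⟨extChartAt I x y, ball_subset_closedBall hy.2, (extChartAt I x).left_inv hy.1⟩
  obtain ⟨t, -, hcover⟩ := isCompact_univ.elim_nhds_subcover V fun x _ => hVn x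
  refine ⟨∑ x ∈ t, C x, ENNReal.sum_lt_top.2 fun x _ => hC x, fun p ρ => ?_⟩
  have hrange : range f ∩ ball p ρ ⊆
      ⋃ x ∈ t, f '' ((extChartAt I x).symm '' closedBall (extChartAt I x x) (r x)) ∩ ball p ρ := by
    rintro _ ⟨⟨y, rfl⟩, hb⟩
    have hy : y ∈ ⋃ x ∈ t, V x := hcover (mem_univ y)
    rw [mem_iUnion₂] at hy
    obtain ⟨x, hx, hyx⟩ := hy
    exact mem_iUnion₂.2 ⟨x, hx, mem_image_of_mem f (hVsub x hyx), hb⟩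
  calc (μH[finrank ℝ E] : Measure F) (range f ∩ ball p ρ)
      ≤ (μH[finrank ℝ E] : Measure F)
          (⋃ x ∈ t, f '' ((extChartAt I x).symm '' closedBall (extChartAt I x x) (r x)) ∩
            ball p ρ) := measure_mono hrange
    _ ≤ ∑ x ∈ t, (μH[finrank ℝ E] : Measure F)
          (f '' ((extChartAt I x).symm '' closedBall (extChartAt I x x) (r x)) ∩ ball p ρ) :=
        measure_biUnion_finset_le _ _
    _ ≤ ∑ x ∈ t, C x * ENNReal.ofReal (ρ ^ finrank ℝ E) :=
        Finset.sum_le_sum fun x _ => hbound x p ρ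
    _ = (∑ x ∈ t, C x) * ENNReal.ofReal (ρ ^ finrank ℝ E) := by rw [Finset.sum_mul]

/-- The same growth bound for a globally `C^n` (`n ≥ 1`) immersion of a compact manifold.
[cite: Federer1969, 2.10.11] -/
theorem exists_hausdorffMeasure_range_inter_ball_le_of_contMDiff [CompactSpace M] {f : M → F}
    {n : WithTop ℕ∞} (hf : ContMDiff I 𝓘(ℝ, F) n f) (hn : 1 ≤ n)
    (hd : ∀ x, Injective (mfderiv I 𝓘(ℝ, F) f x)) :
    ∃ C : ℝ≥0∞, C < ∞ ∧ ∀ (p : F) (ρ : ℝ),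
      (μH[finrank ℝ E] : Measure F) (range f ∩ ball p ρ) ≤ C * ENNReal.ofReal (ρ ^ finrank ℝ E) :=
  exists_hausdorffMeasure_range_inter_ball_le (fun _ => (hf.of_le hn).contMDiffAt) hd

end Manifold

end Literature.MeasureTheory.Hausdorff

end
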